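/- Copyright: the b2b-balaban cell (near-miss cell 7), T⁴-continuum fan-out, lineage t4-ne7b-p1 (node U5c COUNT
member).  Released under the licence of the surrounding project. -/
import Literature.MathematicalPhysics.QuantumFieldTheory.Balaban1983to89.B16CubeCurrency
import Literature.MathematicalPhysics.QuantumFieldTheory.Balaban1983to89.T4PrintedShapeBanking

/-!
# M5-1a — THE VOLUME PROFILE OF ONE REGION ALONG ITS ORBIT, read against the booked window floor and size cost of
its birth event (owner module of row NE7b, lineage `t4-ne7b-p1` gen 42; re-open object (α), `SCOPE-alpha.md` v2.4.1
STATE (3)(i), ruling R-OWNER-42-2 «M5's cost side in TOTAL form» — this is the per-region ATOM common to both forms;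
PRE-POSITIONING ONLY)

Summits-side support leaf of the T⁴-continuum cell (rung (B)+1 on a FINITE torus only; NOT infinite volume, NOT the
mass gap, NOT the Clay statement; NOT a proof of the spine estimate NE7b, which is the cell's OWN estimate, NOT PRINTED
and NOT PROVED).  [folklore] finite combinatorics on `ℤᵈ` and real arithmetic over the index model of
`Balaban1983to89.B16SProfile` (`Sop`, `Siter`, `ratio`, `Qprod`, `DropCtl`, `half_pow_mul_treeLen_ge`,
`two_pow_mul_treeLen_closureIdx_le`), its CUBE CURRENCY `Balaban1983to89.B16CubeCurrency` (`card_Siter_le_cover`,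
`card_profile_h2` — REUSED BY NAME), `Balaban1983to89.TreeLength` (`treeLen`, `card_le_treeLen`) and the lineage's
booked-cost tables `Balaban1983to89.T4PrintedShapeBanking.{floorK, wt, fw, supp, sz, wfloor}` with the dictionary's
`fatWait`∕`dictW`; nothing printed is asserted, no `def … : Prop` fact of Bałaban's is minted, no cite-tagged
hypothesis, zero `sorry`.  B16 pp. 384–385 (1.80)–(1.81) under audit; locators only.

WHY.  M2 brick B (`B16HistoryInputFamily`, leaf-04 p254004) books the large-field cost of a term in VOLUME FORM: a
factor `Λ K j ^ #(c.2)` per level `j` and component `c` (the owner's amendment R4), i.e. a realised per-step cost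
`log (Λ K m) · #(current domain at m)` along each structure's life; M5 (`HistoryGenealogyBanking`) must read it below
the END's booked cost `costT` — per event: the window floor `E₂·R_n^{q′}` on the event's placed window and the decaying
size cost `E₃·R_n^{q′}·wt·2^{−(n−s)}` on its size epoch (`T4PrintedShapeBanking.cost`∕`T4TaggedShapeBanking.costT`).
By `Sop` distributivity a structure's current domain is the union of the iterated images `S^i(Z)` of the regions
introduced on its lines, so the ATOM of that comparison is ONE REGION ALONG ITS OWN ORBIT.  THIS FILE proves the
atom: §1 from the cube-currency profile `|S^i Z| ≤ 126^d·(4·t_i + 1)` (`B16CubeCurrency.card_Siter_le_cover`, `t_i = treeLen (Z^{(i)})`) its decay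
`|S^i Z| ≤ 126^d·(8·(½)^i·treeLen Z + 1)` (`1 ≤ i`), the birth level `|Z| ≤ 2^d·(4·treeLen Z + 1)` (`TreeLength.card_le_treeLen`), and SMALLNESS AFTER
THE FAT WAITING TIME: `t_i < 1`, hence `|S^i Z| ≤ 5·126^d` (`B16CubeCurrency.card_profile_h2`), as soon as `fatWait d′ < i` for any recorded class
`d′ ≥ treeLen Z` (the dictionary's `fatWait d′ = max 1 ⌊log₂ d′⌋` is exactly the index after which `2^i·t_i ≤ t_0`
forces `t_i = 0`); §2 THE STEPWISE READING FOR A LONE LINE: with per-level unit costs `u n ≥ 0` DISPLAYED against the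
tables (`u n · 5·126^d ≤ E₂·R_n^{q′}` — one floor covers a small image; `u n · 8·126^d ≤ E₃·R_n^{q′}` — the size unit),
for every `1 ≤ i` inside the birth window and up to the cutoff,
`u (j+i) · |S^i Z| ≤ wfloor C K R j (j,0,d′) (j+i) + sz C K R (j,0,d′) (j+i)` (`unitCost_card_Siter_le_booked`), and
its sum over any initial segment of the window (`sum_unitCost_card_Siter_le_booked`).  The birth level `i = 0` is NOT
booked by `costT` (the window floor there is one unit, the volume is class-linear): it is displayed separately as the
class-linear bound `|Z| ≤ 2^d·4·(d′ + 1)` (`card_le_classLinear`) for the credit-slack route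
(`HistoryConstantsTH.creditsT_slack`).

WHAT IS *NOT* DONE HERE.  The decomposition of a realised structure's current domain into region orbits (the
`RealisesW` clauses), mergers (cascades are exactly where the STEPWISE form fails and the TOTAL form of R-OWNER-42-2 is
needed — journal «RULING R-OWNER-42-2», O-M5-1), renewed lines, and the assembly of `lifeCost`-form `cost_le` — M5-1b.
HONEST: index-model geometry and the lineage's own bookkeeping; NE7b NOT proved; spine 0∕9.  HONEST DEPENDENCY (cell):
continuum YM on T⁴ ⇐ BetaPertH ∧ nine spine estimates (0∕9 proved); BetaPertH ⇐ (D1) ∧ (D4) ∧ CAP+tail.  This file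
changes none of it.
-/

open Finset
open Literature.MathematicalPhysics.QuantumFieldTheory.Balaban1983to89
open Literature.MathematicalPhysics.QuantumFieldTheory.Balaban1983to89.B13ScaleTransfer
open Literature.MathematicalPhysics.QuantumFieldTheory.Balaban1983to89.TreeLength
open Literature.MathematicalPhysics.QuantumFieldTheory.Balaban1983to89.B16SProfile
open T4PersistenceDictionary T4PrintedShapeBanking

namespace Summit.QuantumFields.BalabanUV.T4Continuum.HistoryBankingVolumeProfile

noncomputable section

variable {d : ℕ}

/-! ## §1 The volume profile of a region's orbit -/

/-- **THE DECAY OF THE VOLUME PROFILE** (`1 ≤ i ≤ m`, `L ≥ 4`): `|S^i Z| ≤ 126^d·(8·(½)^i·treeLen Z + 1)` — the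
scaling `½·t_i ≤ (½)^i·t_0` (`half_pow_mul_treeLen_ge`; no gain claimed at `i = 1`, the printed «for n − j > 1») on the
cube-currency profile `B16CubeCurrency.card_Siter_le_cover`; unlike `card_profile_h1` no lower threshold on `t_i` is asked.
[folklore] -/
theorem card_Siter_le_decay {L : ℕ} {σ : ℕ → ℕ} {m i : ℕ} (hL : 4 ≤ L) (h : DropCtl σ m) {Z : Finset (Pt d)}
    (hZ : Z.Nonempty) (hZc : FaceConnected Z) (hi1 : 1 ≤ i) (hi : i ≤ m) :
    ((Siter (ratio L σ) i Z).card : ℝ) ≤ 126 ^ d * (8 * (1 / 2 : ℝ) ^ i * treeLen Z + 1) := by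
  have h1 := B16CubeCurrency.card_Siter_le_cover (show 3 ≤ L by omega) h hZ hZc hi
  have hh := half_pow_mul_treeLen_ge hL h hZ hZc hi1 hi
  have hp : (0 : ℝ) ≤ 126 ^ d := by positivity
  refine h1.trans (mul_le_mul_of_nonneg_left ?_ hp)
  linarith

/-- **THE CLASS-LINEAR FORM OF THE BIRTH LEVEL**: for any recorded class `d′ ≥ treeLen Z`,
`|Z| ≤ 2^d·4·(d′ + 1)` — the shape paid by the birth-credit slack (`HistoryConstantsTH.creditsT_slack`'s `θ·(d′+1)`),
not by `costT`. [folklore] -/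
theorem card_le_classLinear {Z : Finset (Pt d)} (hZ : Z.Nonempty) (hZc : FaceConnected Z) {d' : ℕ}
    (hd : treeLen Z ≤ d') : (Z.card : ℝ) ≤ 2 ^ d * 4 * ((d' : ℝ) + 1) := by
  have h := card_le_treeLen hZ hZc
  have hp : (0 : ℝ) ≤ 2 ^ d := by positivity
  nlinarith [mul_le_mul_of_nonneg_left hd hp]

/-- **SMALL COVERS BEYOND THE SCALING THRESHOLD**: for `2 ≤ i ≤ m`, `L ≥ 4`, if `treeLen Z < 2^i` then the cover's tree
length is `< 1` (`2^i·t_i ≤ t_0`). [folklore] -/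
theorem treeLen_closureIdx_lt_one {L : ℕ} {σ : ℕ → ℕ} {m i : ℕ} (hL : 4 ≤ L) (h : DropCtl σ m)
    {Z : Finset (Pt d)} (hZ : Z.Nonempty) (hZc : FaceConnected Z) (hi2 : 2 ≤ i) (hi : i ≤ m)
    (ht : treeLen Z < (2 : ℝ) ^ i) : treeLen (closureIdx (Qprod (ratio L σ) i) Z) < 1 := by
  have hsc := two_pow_mul_treeLen_closureIdx_le hL h hZ hZc hi2 hi
  have h2 : (0 : ℝ) < 2 ^ i := by positivity
  by_contra hge
  push Not at hge
  have : (2 : ℝ) ^ i * 1 ≤ 2 ^ i * treeLen (closureIdx (Qprod (ratio L σ) i) Z) :=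
    mul_le_mul_of_nonneg_left hge h2.le
  linarith

/-- The dictionary's fat waiting time dominates the scaling threshold: `fatWait d′ < i` gives `2 ≤ i` and `d′ < 2^i`
(`fatWait d′ = max 1 ⌊log₂ d′⌋`, `Nat.lt_pow_succ_log_self`). [folklore] -/
theorem two_le_and_lt_two_pow_of_fatWait_lt {d' i : ℕ} (hi : fatWait d' < i) : 2 ≤ i ∧ (d' : ℝ) < (2 : ℝ) ^ i := by
  have h1 : 1 ≤ fatWait d' := le_max_left _ _
  have hlog : Nat.log 2 d' < i := lt_of_le_of_lt (le_max_right _ _) hi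
  refine ⟨by omega, ?_⟩
  have hlt : d' < 2 ^ (Nat.log 2 d' + 1) := Nat.lt_pow_succ_log_self (by norm_num) d'
  have hle : 2 ^ (Nat.log 2 d' + 1) ≤ 2 ^ i := Nat.pow_le_pow_right (by norm_num) (by omega)
  exact_mod_cast lt_of_lt_of_le hlt hle

/-- **SMALLNESS AFTER THE FAT WAITING TIME**: for a recorded class `d′ ≥ treeLen Z` and `fatWait d′ < i ≤ m` (`L ≥ 4`),
the cover `Z^{(i)}` has tree length `< 1`. [folklore] -/
theorem treeLen_closureIdx_lt_one_of_fatWait_lt {L : ℕ} {σ : ℕ → ℕ} {m i : ℕ} (hL : 4 ≤ L) (h : DropCtl σ m)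
    {Z : Finset (Pt d)} (hZ : Z.Nonempty) (hZc : FaceConnected Z) {d' : ℕ} (hd : treeLen Z ≤ d')
    (hi : fatWait d' < i) (him : i ≤ m) : treeLen (closureIdx (Qprod (ratio L σ) i) Z) < 1 := by
  obtain ⟨hi2, hlt⟩ := two_le_and_lt_two_pow_of_fatWait_lt hi
  exact treeLen_closureIdx_lt_one hL h hZ hZc hi2 him (lt_of_le_of_lt hd hlt)

/-- **AFTER THE FAT WAITING TIME EVERY IMAGE IS ONE FLOOR UNIT**: `fatWait d′ < i ≤ m`, `treeLen Z ≤ d′`, `L ≥ 4` give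
`|S^i Z| ≤ 5·126^d` (`B16CubeCurrency.card_profile_h2` past the dictionary's threshold). [folklore] -/
theorem card_Siter_le_unit_of_fatWait_lt {L : ℕ} {σ : ℕ → ℕ} {m i : ℕ} (hL : 4 ≤ L) (h : DropCtl σ m)
    {Z : Finset (Pt d)} (hZ : Z.Nonempty) (hZc : FaceConnected Z) {d' : ℕ} (hd : treeLen Z ≤ d')
    (hi : fatWait d' < i) (him : i ≤ m) : ((Siter (ratio L σ) i Z).card : ℝ) ≤ 5 * 126 ^ d :=
  B16CubeCurrency.card_profile_h2 (show 3 ≤ L by omega) h hZ hZc him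
    (treeLen_closureIdx_lt_one_of_fatWait_lt hL h hZ hZc hd hi him)

/-! ## §2 The stepwise reading for a lone line: one region's orbit against its birth event's bookings -/

section Booked

variable (C : T4PrintedShapeBanking.Consts) (K : ℕ) (R : ℕ → ℕ)

/-- the size cost of an event inside its epoch at a performed step, unfolded [folklore] -/
theorem sz_of_mem {e : PEv} {n : ℕ} (h : n ∈ supp C e) (hn : n ≤ K) :
    sz C K R e n = C.E₃ * (R n : ℝ) ^ C.q' * wt C e * (1 / 2 : ℝ) ^ (n - e.step) := by
  unfold sz; rw [if_pos ⟨h, hn⟩]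

/-- the window floor of a birth event of class `d′` at step `j`, at a performed step `j + i` inside the window, is the
floor `E₂·R_{j+i}^{q′}` [folklore] -/
theorem wfloor_birth_of_lt {j i d' : ℕ} (hiW : i < dictW R C.n₁ ((j, 0, d') : PEv)) (hK : j + i ≤ K) :
    wfloor C K R j ((j, 0, d') : PEv) (j + i) = C.E₂ * (R (j + i) : ℝ) ^ C.q' := by
  have hm : j + i ∈ Finset.Ico j (j + dictW R C.n₁ ((j, 0, d') : PEv)) := Finset.mem_Ico.2 ⟨by omega, by omega⟩
  rw [wfloor_of_mem (K := K) hm]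
  unfold floorK; rw [if_pos hK]

/-- the size cost of a birth event of class `d′` at step `j`, at a performed step `j + i` of its epoch
(`1 ≤ i ≤ fatWait d′`), is `E₃·R_{j+i}^{q′}·(d′+1)·(½)^i` [folklore] -/
theorem sz_birth_of_le {j i d' : ℕ} (hi1 : 1 ≤ i) (hi : i ≤ fatWait d') (hK : j + i ≤ K) :
    sz C K R ((j, 0, d') : PEv) (j + i) = C.E₃ * (R (j + i) : ℝ) ^ C.q' * ((d' : ℝ) + 1) * (1 / 2 : ℝ) ^ i := by
  have hmem : j + i ∈ supp C ((j, 0, d') : PEv) := by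
    unfold supp
    rw [fw_kind0 (C := C) (e := ((j, 0, d') : PEv)) rfl, PEv.step_mk, PEv.fat_mk, Finset.mem_Ioc]
    omega
  rw [sz_of_mem C K R hmem hK, wt_kind0 (C := C) (e := ((j, 0, d') : PEv)) rfl, PEv.step_mk, PEv.fat_mk,
    Nat.add_sub_cancel_left]

variable {C K R}

/-- **THE STEPWISE READING FOR A LONE LINE.**  A non-empty face-connected region `Z` born at step `j` with recorded
class `d′ ≥ treeLen Z`, per-level unit costs `u ≥ 0` DISPLAYED against the tables — `u n · 5·126^d ≤ E₂·R_n^{q′}` (one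
floor covers a small image) and `u n · 8·126^d ≤ E₃·R_n^{q′}` (the size unit), both at performed steps `n ≤ K` — and
the flow's `DropCtl σ m`, `L ≥ 4`: at every later step `j + i` inside the birth window (`1 ≤ i < dictW R n₁ (j,0,d′)`,
`i ≤ m`, `j + i ≤ K`) the realised volume cost of the image is below the event's booked floor plus size cost,
`u (j+i) · |S^i Z| ≤ wfloor C K R j (j,0,d′) (j+i) + sz C K R (j,0,d′) (j+i)`.  (Fat steps `i ≤ fatWait d′`: decay
`|S^i Z| ≤ 126^d(8(½)^i t_0 + 1)`, the size part against `sz`, the unit against the floor; later steps: the image is one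
floor unit.) [folklore] -/
theorem unitCost_card_Siter_le_booked {L : ℕ} {σ : ℕ → ℕ} {m : ℕ} (hL : 4 ≤ L) (h : DropCtl σ m)
    {Z : Finset (Pt d)} (hZ : Z.Nonempty) (hZc : FaceConnected Z) {d' : ℕ} (hd : treeLen Z ≤ d')
    (hE₃ : 0 ≤ C.E₃) {u : ℕ → ℝ} (hu : ∀ n, 0 ≤ u n)
    (huE₂ : ∀ n, n ≤ K → u n * (5 * 126 ^ d) ≤ C.E₂ * (R n : ℝ) ^ C.q')
    (huE₃ : ∀ n, n ≤ K → u n * (8 * 126 ^ d) ≤ C.E₃ * (R n : ℝ) ^ C.q')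
    {j i : ℕ} (hi1 : 1 ≤ i) (him : i ≤ m) (hK : j + i ≤ K) (hiW : i < dictW R C.n₁ ((j, 0, d') : PEv)) :
    u (j + i) * ((Siter (ratio L σ) i Z).card : ℝ) ≤
      wfloor C K R j ((j, 0, d') : PEv) (j + i) + sz C K R ((j, 0, d') : PEv) (j + i) := by
  have hfl := wfloor_birth_of_lt C K R hiW hK
  have hu0 := hu (j + i)
  have h2 := huE₂ (j + i) hK
  rcases Nat.lt_or_ge (fatWait d') i with hlate | hfat
  · -- after the fat waiting time: one floor unit, the size cost is nonnegative
    have hsm := card_Siter_le_unit_of_fatWait_lt hL h hZ hZc hd hlate him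
    have hsz : 0 ≤ sz C K R ((j, 0, d') : PEv) (j + i) := sz_nonneg hE₃ _ _
    rw [hfl]
    nlinarith [mul_le_mul_of_nonneg_left hsm hu0]
  · -- inside the size epoch: decay against `sz`, the unit against the floor
    have hdec := card_Siter_le_decay hL h hZ hZc hi1 him
    have hszv := sz_birth_of_le C K R hi1 hfat hK
    have h3 := huE₃ (j + i) hK
    have hp : (0 : ℝ) ≤ 126 ^ d := by positivity
    have hhalf : (0 : ℝ) ≤ (1 / 2 : ℝ) ^ i := by positivity
    have ht0 : 0 ≤ treeLen Z := treeLen_nonneg Z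
    have hd1 : treeLen Z ≤ (d' : ℝ) + 1 := by linarith
    rw [hfl, hszv]
    -- u·|S^i Z| ≤ u·126^d·8·(½)^i·t_0 + u·126^d ≤ E₃ R^{q'} (½)^i t_0 + E₂ R^{q'} ≤ sz + floor
    have step1 : u (j + i) * ((Siter (ratio L σ) i Z).card : ℝ) ≤
        u (j + i) * (8 * 126 ^ d) * ((1 / 2 : ℝ) ^ i * treeLen Z) + u (j + i) * (5 * 126 ^ d) := by
      have := mul_le_mul_of_nonneg_left hdec hu0
      nlinarith [mul_nonneg hu0 hp]
    have step2 : u (j + i) * (8 * 126 ^ d) * ((1 / 2 : ℝ) ^ i * treeLen Z) ≤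
        C.E₃ * (R (j + i) : ℝ) ^ C.q' * ((1 / 2 : ℝ) ^ i * treeLen Z) :=
      mul_le_mul_of_nonneg_right h3 (mul_nonneg hhalf ht0)
    have step3 : C.E₃ * (R (j + i) : ℝ) ^ C.q' * ((1 / 2 : ℝ) ^ i * treeLen Z) ≤
        C.E₃ * (R (j + i) : ℝ) ^ C.q' * ((d' : ℝ) + 1) * (1 / 2 : ℝ) ^ i := by
      have hE : 0 ≤ C.E₃ * (R (j + i) : ℝ) ^ C.q' := mul_nonneg hE₃ (by positivity)
      have := mul_le_mul_of_nonneg_left (mul_le_mul_of_nonneg_left hd1 hhalf) hE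
      linarith [this]
    linarith

/-- **THE SUM OVER AN INITIAL SEGMENT OF THE WINDOW** (the lone line's contribution to the TOTAL form): for
`1 ≤ i ≤ ℓ` with `ℓ ≤ m`, `j + ℓ ≤ K`, `ℓ < dictW R n₁ (j,0,d′)`,
`Σ_{i=1}^{ℓ} u (j+i)·|S^i Z| ≤ Σ_{i=1}^{ℓ} (wfloor … (j+i) + sz … (j+i))`. [folklore] -/
theorem sum_unitCost_card_Siter_le_booked {L : ℕ} {σ : ℕ → ℕ} {m : ℕ} (hL : 4 ≤ L) (h : DropCtl σ m)
    {Z : Finset (Pt d)} (hZ : Z.Nonempty) (hZc : FaceConnected Z) {d' : ℕ} (hd : treeLen Z ≤ d')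
    (hE₃ : 0 ≤ C.E₃) {u : ℕ → ℝ} (hu : ∀ n, 0 ≤ u n)
    (huE₂ : ∀ n, n ≤ K → u n * (5 * 126 ^ d) ≤ C.E₂ * (R n : ℝ) ^ C.q')
    (huE₃ : ∀ n, n ≤ K → u n * (8 * 126 ^ d) ≤ C.E₃ * (R n : ℝ) ^ C.q')
    {j ℓ : ℕ} (hℓm : ℓ ≤ m) (hK : j + ℓ ≤ K) (hℓW : ℓ < dictW R C.n₁ ((j, 0, d') : PEv)) :
    ∑ i ∈ Finset.Icc 1 ℓ, u (j + i) * ((Siter (ratio L σ) i Z).card : ℝ) ≤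
      ∑ i ∈ Finset.Icc 1 ℓ, (wfloor C K R j ((j, 0, d') : PEv) (j + i) + sz C K R ((j, 0, d') : PEv) (j + i)) := by
  refine Finset.sum_le_sum fun i hi => ?_
  rw [Finset.mem_Icc] at hi
  exact unitCost_card_Siter_le_booked hL h hZ hZc hd hE₃ hu huE₂ huE₃ hi.1 (hi.2.trans hℓm) (by omega)
    (lt_of_le_of_lt hi.2 hℓW)

end Booked

/-! ## §3 Sanity: the displays are jointly satisfiable and the atom is not vacuous -/

/-- With `u n := 1`, `E₂ := 5·126^d`, `E₃ := 8·126^d`, `q′ := 0` the two displays hold with equality for every size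
function `R` — the hypotheses of `unitCost_card_Siter_le_booked` are jointly satisfiable, non-trivially. [folklore] -/
theorem displays_inhabited (d : ℕ) (R : ℕ → ℕ) (n : ℕ) :
    (1 : ℝ) * (5 * 126 ^ d) ≤ (5 * 126 ^ d) * (R n : ℝ) ^ (0 : ℕ) ∧
      (1 : ℝ) * (8 * 126 ^ d) ≤ (8 * 126 ^ d) * (R n : ℝ) ^ (0 : ℕ) := by
  simp

end

end Summit.QuantumFields.BalabanUV.T4Continuum.HistoryBankingVolumeProfile
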